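import Literature.AnabelianGeometry.AbsoluteAnabelian.AbsTopIII.KummerSeparationLawsV2
import Literature.AnabelianGeometry.AbsoluteAnabelian.AbsTopIII.Thm19KummerTowerBridge
import Literature.AnabelianGeometry.AbsoluteAnabelian.AbsTopIII.Thm19EvaluationSaturated
import HarnessLib

/-!
# [AbsTopIII] Thm. 1.9 (e): the POINT dictionary of a saturated tagged system, derived from the per-curve
# laws (proof-only; part 1: transition geometry, `SamePoint` versus equality of places)

Mochizuki, *Topics in Absolute Anabelian Geometry III*, §1, Theorem 1.9 (e), manuscript p. 38 (lit key
`paper:url-5493eb38cbb7`): "One constructs the additive structure on [...] `K_{Z_NF}^× ∪ {0}` by applying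
the functorial algorithm of Proposition 1.3 to the data `K_X^×`, `{ord_x}_{x ∈ X(k)}`, `{U_v}` [so we have
a natural bijection `V_X ⥲ X(k)`]".

Cell abc-iut, sub-DAG `plan/L4/SUBDAG-AbsTopIII-Thm19.md`, row Thm19.e.r11 (statement of record
`IntrinsicKummerModel.Thm19eSat`); the (e)-BRIDGE of abc-iut-L4-lead RULING #5j (3): deriving the
hypothesis of `thm19eSat_of_dictionary` — here its (e1) POINT part — from the per-curve laws of the six-layer
tower `PlacedKummerModelV2` (abc-iut-L4-t1 layers I–IV; layers V–VI = abc-iut-w5-d213's texts in abc-iut-L4-t1's v2 successor structures `SeparatedKummerModelV2` ⊆ `PlacedKummerModelV2`, KummerSeparationLawsV2.lean — PORT of the v1 file `Thm19DictionaryBridgePoints.lean` to the statements of record, abc-iut-L4-lead RULING #7r) for systems carrying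
geometric tags (`NFComplementSystem.GeomTags`).  THIS FILE: the geometry of a tagged transition
`V_j ⊆ W_{ij} → V_i` on closed points (image point, compatibility with the compactifications and with the
named PLACE `nfPlace`, the `LiesOver` relation of decomposition groups), the separation of points by
finite-index subgroups of decomposition groups (layer V (S-fin)), and the two directions of
"`SamePoint a b ↔` the places named by `a` and `b` coincide" (layer III `exists_common_of_nfPlace_eq` / `nfPlace_bcPt`, the cofinality tag, layer VI fibre law), and SURJECTIVITY onto the places for a SATURATED system (`IsSaturated`: layer III `nfPlace_surjective` + layer VI place law `nfPlace_eq_of_decomp_le`) — packaged as `exists_pointDictionary`.  All theorems; no definition, no new named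
fact; nothing here bears on [IUTchIII] Cor. 3.12.
-/

noncomputable section

open CategoryTheory
open scoped Pointwise

namespace Literature.AnabelianGeometry.AbsoluteAnabelian.AbsTopIII

open Literature.NumberTheory.DiophantineGeometry
open Literature.NumberTheory.DiophantineGeometry.AlgFunctionField

universe u

/-! ### Group-theoretic helpers: conjugates under homomorphisms, finite-index containment -/

namespace CurveModel

/-- `f(g K g⁻¹) = f(g) f(K) f(g)⁻¹` (local copy of `EtaleTheta.GalSect.map_conj_smul`, kept private to avoid a
cross-area import). [cite: MochizukiAbsTopIII2015, Thm 1.9 (a) p.37] -/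
private theorem map_conj_smul {G H : Type*} [Group G] [Group H] (f : G →* H) (g : G) (K : Subgroup G) :
    (MulAut.conj g • K).map f = MulAut.conj (f g) • K.map f := by
  rw [Subgroup.pointwise_smul_def, Subgroup.pointwise_smul_def, Subgroup.map_map, Subgroup.map_map]
  congr 1
  ext x
  simp [MulAut.conj_apply, map_mul, map_inv]

/-- `g • (g' • K) = (g g') • K` for conjugation. [cite: MochizukiAbsTopIII2015, Thm 1.9 (a) p.37] -/
theorem conj_smul_conj_smul {G : Type*} [Group G] (g g' : G) (K : Subgroup G) :
    MulAut.conj g • MulAut.conj g' • K = MulAut.conj (g * g') • K := by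
  rw [← mul_smul, ← map_mul]

end CurveModel

namespace SeparatedKummerModelV2

variable (N : SeparatedKummerModelV2.{u})

/-- **Separation, conjugated form** (layer V (S-fin)): if a subgroup `H₀` of FINITE index in a conjugate
`a D_{x′} a⁻¹` lies in a conjugate of `D_x`, then `x′ = x`.
[cite: MochizukiAbsTopIII2015, Thm 1.9 (e) p.38] -/
theorem point_eq_of_relIndex_conj {X : N.Curve} (hX : N.IsScheme X) (hg : 2 ≤ N.genus X)
    (hk : IsKummerFaithful (N.base X)) {x x' : N.Point X} {H₀ : Subgroup (N.ext X).arith}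
    {a g : (N.ext X).arith} (h1 : H₀ ≤ MulAut.conj a • N.decomp X x')
    (h2 : H₀.relIndex (MulAut.conj a • N.decomp X x') ≠ 0) (h3 : H₀ ≤ MulAut.conj g • N.decomp X x) :
    x' = x := by
  have ha : MulAut.conj a⁻¹ • MulAut.conj a • N.decomp X x' = N.decomp X x' := by
    rw [CurveModel.conj_smul_conj_smul, inv_mul_cancel, map_one, one_smul]
  refine N.point_eq_of_finiteIndex_le_conj X hX hg hk x x' (MulAut.conj a⁻¹ • H₀) (a⁻¹ * g) ?_ ?_ ?_
  · rw [← ha]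
    exact Subgroup.pointwise_smul_le_pointwise_smul_iff.mpr h1
  · rw [← ha, Subgroup.relIndex_pointwise_smul]
    exact h2
  · rw [map_mul, mul_smul]
    exact Subgroup.pointwise_smul_le_pointwise_smul_iff.mpr h3

end SeparatedKummerModelV2

/-! ### Transition geometry of a tagged system on closed points -/

namespace PlacedKummerModelV2

variable (N : PlacedKummerModelV2.{u}) {Z : N.Curve} {ι : Type u} [Preorder ι]
  (S : CurveModel.NFComplementSystem N.toCurveModel Z ι)
  (T : CurveModel.NFComplementSystem.GeomTags N.toDescentKummerModel S)

/-- The image point of `w ∈ V_j` under the transition `V_j ⊆ W_{ij} → V_i`, viewed in the compactification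
`Z_i`, is the image of `w ∈ Z_j` under the base-change leg `Z_j → Z_i` (`bcPt_ptRes`, `ptRes_comp`).
[cite: MochizukiAbsTopIII2015, Thm 1.9 (d) p.37] -/
theorem ptRes_imgPt {i j : ι} (h : i ≤ j) (w : N.Point (S.V j)) :
    N.ptRes (S.isOpen i) (N.bcPt (T.hWV h) (N.ptRes (T.hVW h) w)) =
      N.bcPt (T.hZZ h) (N.ptRes (S.isOpen j) w) := by
  rw [N.bcPt_ptRes (T.hWV h) (T.hZZ h) (S.isOpen i) (T.hWZ h), ← N.ptRes_comp (T.hVW h) (T.hWZ h)]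

/-- The `Π`-component of the transition `Π_{V_j} → Π_{V_i}` of a tagged system is the composite of the
open immersion `V_j ⊆ W_{ij}` and the base-change leg `W_{ij} → V_i` on subgroups.
[cite: MochizukiAbsTopIII2015, Thm 1.9 (d) p.37] -/
theorem map_trans_eq {i j : ι} (h : i ≤ j) (D : Subgroup (N.ext (S.V j)).arith) :
    D.map (S.trans h).arith.toMonoidHom =
      (D.map (N.res (T.hVW h)).arith.toMonoidHom).map (N.bc (T.hWV h)).arith.toMonoidHom := by
  rw [T.trans_eq h, Subgroup.map_map]
  rfl

/-- **The decomposition group of `w ∈ V_j` lies over the image point** under the transition, inside a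
conjugate of its decomposition group of FINITE index (`decomp_ptRes`, layer V `decomp_bcPt_finiteIndex`).
[cite: MochizukiAbsTopIII2015, Thm 1.9 (a) p.37] -/
theorem decomp_map_trans {i j : ι} (h : i ≤ j) (w : N.Point (S.V j)) :
    ∃ a : (N.ext (S.V i)).arith,
      (N.decomp (S.V j) w).map (S.trans h).arith.toMonoidHom ≤
          MulAut.conj a • N.decomp (S.V i) (N.bcPt (T.hWV h) (N.ptRes (T.hVW h) w)) ∧
        ((N.decomp (S.V j) w).map (S.trans h).arith.toMonoidHom).relIndex
            (MulAut.conj a • N.decomp (S.V i) (N.bcPt (T.hWV h) (N.ptRes (T.hVW h) w))) ≠ 0 := by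
  obtain ⟨g₁, h₁⟩ := N.decomp_ptRes (T.hVW h) w
  obtain ⟨g₂, h₂, h₂'⟩ := N.decomp_bcPt_finiteIndex (T.hWV h) (N.ptRes (T.hVW h) w)
  refine ⟨(N.bc (T.hWV h)).arith.toMonoidHom g₁ * g₂, ?_, ?_⟩
  · rw [N.map_trans_eq S T h, h₁, CurveModel.map_conj_smul, ← CurveModel.conj_smul_conj_smul]
    exact Subgroup.pointwise_smul_le_pointwise_smul_iff.mpr h₂
  · rw [N.map_trans_eq S T h, h₁, CurveModel.map_conj_smul, ← CurveModel.conj_smul_conj_smul,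
      Subgroup.relIndex_pointwise_smul]
    exact h₂'

/-- Hence `LiesOver`: the decomposition group of `w ∈ V_j` lies over the image point of `w` in `V_i`.
[cite: MochizukiAbsTopIII2015, Thm 1.9 (a) p.37] -/
theorem liesOver_decomp_imgPt {i j : ι} (h : i ≤ j) (w : N.Point (S.V j)) :
    N.LiesOver S h (N.decomp (S.V j) w) (N.bcPt (T.hWV h) (N.ptRes (T.hVW h) w)) := by
  obtain ⟨a, ha, -⟩ := N.decomp_map_trans S T h w
  exact ⟨a, ha⟩

/-- A cusp `c` of `V_j` filling the point `w₀` of `W_{ij}` lies over the image of `w₀` in `V_i`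
(`decomp_cuspPt`, `decomp_bcPt`). [cite: MochizukiAbsTopIII2015, Thm 1.9 (a) p.37] -/
theorem liesOver_dcusp_of_cuspPt {i j : ι} (h : i ≤ j) (c : (N.cusps (S.V j)).Cusp)
    (w₀ : N.Point (T.W h)) (hc : N.cuspPt (T.hVW h) c = some w₀) :
    N.LiesOver S h ((N.cusps (S.V j)).Dcusp c) (N.bcPt (T.hWV h) w₀) := by
  obtain ⟨g₁, h₁⟩ := N.decomp_cuspPt (T.hVW h) c w₀ hc
  obtain ⟨g₂, h₂⟩ := N.decomp_bcPt (T.hWV h) w₀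
  refine ⟨(N.bc (T.hWV h)).arith.toMonoidHom g₁ * g₂, ?_⟩
  rw [N.map_trans_eq S T h, h₁, CurveModel.map_conj_smul, ← CurveModel.conj_smul_conj_smul]
  exact Subgroup.pointwise_smul_le_pointwise_smul_iff.mpr h₂

/-- **A point decomposition group lying over `x` names `x`**: if `D_w` (`w ∈ V_j` an NF-point) lies over
the point `x ∈ V_i` along the transition, then the image point of `w` IS `x` (layer V (S-fin) at `V_i`:
scheme-like, genus `≥ 2` (`= genus Z`), base sub-`p`-adic hence Kummer-faithful by Rmk. 1.5.4 (i)).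
[cite: MochizukiAbsTopIII2015, Thm 1.9 (e) p.38] -/
theorem imgPt_eq_of_liesOver (h154 : Rmk_1_5_4_i.{u}) (hZ : N.IsThm19dInput Z) {i j : ι} (h : i ≤ j)
    (w : N.Point (S.V j)) (x : N.Point (S.V i)) (hw : N.LiesOver S h (N.decomp (S.V j) w) x) :
    N.bcPt (T.hWV h) (N.ptRes (T.hVW h) w) = x := by
  obtain ⟨a, h1, h2⟩ := N.decomp_map_trans S T h w
  obtain ⟨g, h3⟩ := hw
  have hg : 2 ≤ N.genus (S.V i) := by
    rw [N.genus_eq_of_isCofiniteOpen (S.isOpen i), S.genus_eq i]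
    exact hZ.two_le_genus
  exact N.point_eq_of_relIndex_conj (S.isScheme i).1 hg (h154 _ (S.isSubpadic i)) h1 h2 h3

/-! ### Cusps lying over points -/

/-- **A cusp lying over a point is not a cusp of `W`**: a cusp `c` of `V_j` whose decomposition group lies
over a POINT `x` of `V_i` fills a point of `W_{ij}` — otherwise its image would contain the inertia group
of a cusp of `W_{ij}` (nontrivial: Prop. 1.4 (i), free procyclic) mapped injectively into `Δ_{V_i}`, inside
a conjugate of `D_x`, contradicting `D_x ∩ Δ_{V_i} = 1` (layer IV `decomp_inf_geom`).
[cite: MochizukiAbsTopIII2015, Thm 1.9 (a) p.37] -/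
theorem cuspPt_ne_none_of_liesOver (h14i : N.Prop_1_4_i) {i j : ι} (h : i ≤ j)
    (c : (N.cusps (S.V j)).Cusp) (x : N.Point (S.V i))
    (hc : N.LiesOver S h ((N.cusps (S.V j)).Dcusp c) x) : N.cuspPt (T.hVW h) c ≠ none := by
  intro hnone
  obtain ⟨c'', g', h1⟩ := N.decomp_cuspPt_none (T.hVW h) c hnone
  obtain ⟨g, h2⟩ := hc
  set β := (N.bc (T.hWV h)).arith.toMonoidHom with hβ
  rw [N.map_trans_eq S T h, h1, CurveModel.map_conj_smul] at h2
  have h3 : ((N.cusps (T.W h)).Dcusp c'').map β ≤ MulAut.conj ((β g')⁻¹ * g) • N.decomp (S.V i) x := by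
    rw [show MulAut.conj g • N.decomp (S.V i) x =
        MulAut.conj (β g') • MulAut.conj ((β g')⁻¹ * g) • N.decomp (S.V i) x by
      rw [CurveModel.conj_smul_conj_smul, mul_inv_cancel_left]] at h2
    exact Subgroup.pointwise_smul_le_pointwise_smul_iff.mp h2
  have hW : N.IsScheme (T.W h) := (N.isScheme_bc (T.hWV h)).2 (S.isScheme i).1
  have hbot := N.decomp_inf_geom (S.V i) (S.isScheme i).1 x
  -- every element of `I_{c''}` is trivial
  have htriv : ∀ y : (N.ext (T.W h)).arith, y ∈ (N.cusps (T.W h)).Icusp c'' → y = 1 := by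
    intro y hy
    have hyD : β y ∈ ((N.cusps (T.W h)).Dcusp c'').map β :=
      Subgroup.mem_map_of_mem β ((N.cusps (T.W h)).Icusp_le_Dcusp c'' hy)
    have hyΔ : β y ∈ (N.ext (S.V i)).geom :=
      (N.bc (T.hWV h)).mapsTo_geom ((N.cusps (T.W h)).Icusp_le_geom c'' hy)
    have h4 := h3 hyD
    rw [Subgroup.mem_pointwise_smul_iff_inv_smul_mem, MulAut.smul_def, MulAut.conj_inv_apply] at h4
    have h5 : ((β g')⁻¹ * g)⁻¹ * β y * ((β g')⁻¹ * g) ∈ (N.ext (S.V i)).geom := by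
      have := (N.ext (S.V i)).normal_geom.conj_mem _ hyΔ ((β g')⁻¹ * g)⁻¹
      rwa [inv_inv] at this
    have h6 : ((β g')⁻¹ * g)⁻¹ * β y * ((β g')⁻¹ * g) ∈ N.decomp (S.V i) x ⊓ (N.ext (S.V i)).geom :=
      ⟨h4, h5⟩
    rw [hbot, Subgroup.mem_bot] at h6
    have h7 : β y = 1 := by
      have h8 : β y = ((β g')⁻¹ * g) * (((β g')⁻¹ * g)⁻¹ * β y * ((β g')⁻¹ * g)) * ((β g')⁻¹ * g)⁻¹ := by
        group
      rw [h8, h6, mul_one, mul_inv_cancel]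
    exact (N.isOpenInjective_bc (T.hWV h)).arith_injective (by rw [map_one]; exact h7)
  -- but `I_{c''}` is free procyclic, in particular it has a subgroup of index `2`
  obtain ⟨H, -, hH⟩ := (h14i (T.W h) hW c'').exists_isOpen_index 2 two_pos
  have hsub : Subsingleton ((N.cusps (T.W h)).Icusp c'') :=
    ⟨fun p q => Subtype.ext ((htriv p.1 p.2).trans (htriv q.1 q.2).symm)⟩
  have hH' : H = ⊤ := Subgroup.ext fun p => ⟨fun _ => trivial, fun _ => by
    rw [Subsingleton.elim p 1]; exact H.one_mem⟩
  rw [hH', Subgroup.index_top] at hH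
  exact absurd hH (by decide)

/-- **A cusp decomposition group lying over `x` names `x`**: if the cusp `c` of `V_j` lies over the point
`x ∈ V_i`, then `c` fills a point `w₀` of `W_{ij}` whose image in `V_i` IS `x` (layer V (S-fin), with the
finite-index containment from `decomp_cuspPt` and layer V `decomp_bcPt_finiteIndex`).
[cite: MochizukiAbsTopIII2015, Thm 1.9 (e) p.38] -/
theorem exists_cuspPt_of_liesOver (h154 : Rmk_1_5_4_i.{u}) (h14i : N.Prop_1_4_i) (hZ : N.IsThm19dInput Z)
    {i j : ι} (h : i ≤ j) (c : (N.cusps (S.V j)).Cusp) (x : N.Point (S.V i))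
    (hc : N.LiesOver S h ((N.cusps (S.V j)).Dcusp c) x) :
    ∃ w₀ : N.Point (T.W h), N.cuspPt (T.hVW h) c = some w₀ ∧ N.bcPt (T.hWV h) w₀ = x := by
  obtain ⟨w₀, hw₀⟩ := Option.ne_none_iff_exists'.mp (N.cuspPt_ne_none_of_liesOver S T h14i h c x hc)
  refine ⟨w₀, hw₀, ?_⟩
  obtain ⟨g₁, h₁⟩ := N.decomp_cuspPt (T.hVW h) c w₀ hw₀
  obtain ⟨g₂, h₂, h₂'⟩ := N.decomp_bcPt_finiteIndex (T.hWV h) w₀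
  obtain ⟨g, h3⟩ := hc
  set β := (N.bc (T.hWV h)).arith.toMonoidHom with hβ
  rw [N.map_trans_eq S T h, h₁, CurveModel.map_conj_smul] at h3
  have hg : 2 ≤ N.genus (S.V i) := by
    rw [N.genus_eq_of_isCofiniteOpen (S.isOpen i), S.genus_eq i]
    exact hZ.two_le_genus
  refine N.point_eq_of_relIndex_conj (S.isScheme i).1 hg (h154 _ (S.isSubpadic i))
    (H₀ := MulAut.conj (β g₁) • (N.decomp (T.W h) w₀).map β) (a := β g₁ * g₂) (g := g) ?_ ?_ h3
  · rw [← CurveModel.conj_smul_conj_smul]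
    exact Subgroup.pointwise_smul_le_pointwise_smul_iff.mpr h₂
  · rw [← CurveModel.conj_smul_conj_smul, Subgroup.relIndex_pointwise_smul]
    exact h₂'

/-! ### The point of the compactification `Z_k` named by a level subgroup lying over `x` -/

/-- If the decomposition group of the NF-point `w ∈ V_k` lies over `x ∈ V_i`, then `w ∈ Z_k` lies over
`x ∈ Z_i` along the base-change leg `Z_k → Z_i`. [cite: MochizukiAbsTopIII2015, Thm 1.9 (e) p.38] -/
theorem bcPt_ptRes_eq_of_liesOver (h154 : Rmk_1_5_4_i.{u}) (hZ : N.IsThm19dInput Z) {i k : ι}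
    (h : i ≤ k) (w : N.Point (S.V k)) (x : N.Point (S.V i))
    (hw : N.LiesOver S h (N.decomp (S.V k) w) x) :
    N.bcPt (T.hZZ h) (N.ptRes (S.isOpen k) w) = N.ptRes (S.isOpen i) x := by
  rw [← N.ptRes_imgPt S T h w, N.imgPt_eq_of_liesOver S T h154 hZ h w x hw]

/-- If the decomposition group of the cusp `c` of `V_k` lies over `x ∈ V_i`, then the point of `Z_k` that
`c` fills lies over `x ∈ Z_i` along `Z_k → Z_i` (layer IV `cuspPt_comp_some`, layer II `bcPt_ptRes`).
[cite: MochizukiAbsTopIII2015, Thm 1.9 (e) p.38] -/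
theorem bcPt_eq_of_dcusp_liesOver (h154 : Rmk_1_5_4_i.{u}) (h14i : N.Prop_1_4_i)
    (hZ : N.IsThm19dInput Z) {i k : ι} (h : i ≤ k) (c : (N.cusps (S.V k)).Cusp) (x : N.Point (S.V i))
    (hc : N.LiesOver S h ((N.cusps (S.V k)).Dcusp c) x) (p : N.Point (S.Zb k))
    (hp : N.cuspPt (S.isOpen k) c = some p) :
    N.bcPt (T.hZZ h) p = N.ptRes (S.isOpen i) x := by
  obtain ⟨w₀, hw₀, hx⟩ := N.exists_cuspPt_of_liesOver S T h154 h14i hZ h c x hc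
  have hp' : N.cuspPt (S.isOpen k) c = some (N.ptRes (T.hWZ h) w₀) :=
    N.cuspPt_comp_some (T.hVW h) (T.hWZ h) (S.isOpen k) c w₀ hw₀
  rw [hp] at hp'
  cases hp'
  rw [← N.bcPt_ptRes (T.hWV h) (T.hZZ h) (S.isOpen i) (T.hWZ h), hx]

/-! ### `SamePoint` implies equality of the named places -/

/-- Congruence of `nfPlace` in the point (its NF-point / rationality arguments are proofs).
[cite: MochizukiAbsTopIII2015, Thm 1.9 (e) p.38] -/
theorem nfPlace_congr {Z' : N.Curve} (h : N.IsBaseChangeOf Z' Z) {x x' : N.Point Z'} (hxx' : x = x')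
    (hx : N.IsNFPoint Z' x) (hr : N.IsRationalPt Z' x) (hx' : N.IsNFPoint Z' x')
    (hr' : N.IsRationalPt Z' x') : N.nfPlace h x hx hr = N.nfPlace h x' hx' hr' := by
  subst hxx'
  rfl

/-- The place named by a rational NF-point `x ∈ V_i` is the place named by any point `p ∈ Z_k` (`i ≤ k`)
lying over it along `Z_k → Z_i` (layer III `nfPlace_bcPt`).
[cite: MochizukiAbsTopIII2015, Thm 1.9 (e) p.38] -/
theorem nfPlace_eq_of_bcPt_eq {i k : ι} (h : i ≤ k) (x : N.Point (S.V i))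
    (hx : N.IsNFPoint (S.V i) x) (hr : N.IsRationalPt (S.V i) x) (p : N.Point (S.Zb k))
    (hp : N.bcPt (T.hZZ h) p = N.ptRes (S.isOpen i) x) :
    ∃ (hp₁ : N.IsNFPoint (S.Zb k) p) (hp₂ : N.IsRationalPt (S.Zb k) p),
      N.nfPlace (T.hZb i) (N.ptRes (S.isOpen i) x)
          ((N.isNFPoint_ptRes (S.isOpen i) (S.isNFCurve i) x).2 hx)
          ((N.isRationalPt_ptRes (S.isOpen i) x).2 hr) =
        N.nfPlace (T.hZb k) p hp₁ hp₂ := by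
  have hxZ : N.IsNFPoint (S.Zb i) (N.ptRes (S.isOpen i) x) :=
    (N.isNFPoint_ptRes (S.isOpen i) (S.isNFCurve i) x).2 hx
  have hrZ : N.IsRationalPt (S.Zb i) (N.ptRes (S.isOpen i) x) := (N.isRationalPt_ptRes (S.isOpen i) x).2 hr
  have hp₁ : N.IsNFPoint (S.Zb k) p := by
    rw [N.isNFPoint_bcPt (T.hZZ h) (N.isNFCurve_of_isCofiniteOpen (S.isOpen i) (S.isNFCurve i)) p, hp]
    exact hxZ
  have hp₂ : N.IsRationalPt (S.Zb k) p := N.isRationalPt_of_bcPt (T.hZZ h) p (by rw [hp]; exact hrZ)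
  refine ⟨hp₁, hp₂, ?_⟩
  have hx' : N.IsNFPoint (S.Zb i) (N.bcPt (T.hZZ h) p) := by rw [hp]; exact hxZ
  have hr' : N.IsRationalPt (S.Zb i) (N.bcPt (T.hZZ h) p) := by rw [hp]; exact hrZ
  rw [N.nfPlace_congr (T.hZb i) hp.symm _ _ hx' hr', N.nfPlace_bcPt (T.hZZ h) (T.hZb i) (T.hZb k) p hp₁ hp₂]

/-- **`SamePoint a b` ⟹ `a` and `b` name the same place of `K_{Z_NF}/k̄_NF`** (the (→) half of the point
dictionary (e1)): a point or cusp of a deeper level lying over both names, in the compactification, ONE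
point lying over both (layer V separation), and points related along the base-change legs name the same
place (layer III `nfPlace_bcPt`). [cite: MochizukiAbsTopIII2015, Thm 1.9 (e) p.38] -/
theorem nfPlace_eq_of_samePoint (h154 : Rmk_1_5_4_i.{u}) (h14i : N.Prop_1_4_i) (hZ : N.IsThm19dInput Z)
    (a b : N.NFPointIndex S) (hab : N.SamePoint S a b) :
    N.nfPlace (T.hZb a.1) (N.ptRes (S.isOpen a.1) a.2.1)
        ((N.isNFPoint_ptRes (S.isOpen a.1) (S.isNFCurve a.1) a.2.1).2 a.2.2.1)
        ((N.isRationalPt_ptRes (S.isOpen a.1) a.2.1).2 a.2.2.2) =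
      N.nfPlace (T.hZb b.1) (N.ptRes (S.isOpen b.1) b.2.1)
        ((N.isNFPoint_ptRes (S.isOpen b.1) (S.isNFCurve b.1) b.2.1).2 b.2.2.1)
        ((N.isRationalPt_ptRes (S.isOpen b.1) b.2.1).2 b.2.2.2) := by
  obtain ⟨k, ha, hb, D, hD, hDa, hDb⟩ := hab
  -- the point `p ∈ Z_k` named by `D`, lying over both `a` and `b`
  obtain ⟨p, hpa, hpb⟩ : ∃ p : N.Point (S.Zb k),
      N.bcPt (T.hZZ ha) p = N.ptRes (S.isOpen a.1) a.2.1 ∧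
        N.bcPt (T.hZZ hb) p = N.ptRes (S.isOpen b.1) b.2.1 := by
    rcases hD with ⟨w, -, rfl⟩ | ⟨c, rfl⟩
    · exact ⟨N.ptRes (S.isOpen k) w, N.bcPt_ptRes_eq_of_liesOver S T h154 hZ ha w _ hDa,
        N.bcPt_ptRes_eq_of_liesOver S T h154 hZ hb w _ hDb⟩
    · obtain ⟨p, hp⟩ := Option.isSome_iff_exists.mp (N.cuspPt_isSome (S.isOpen k) (S.isProper k) c)
      exact ⟨p, N.bcPt_eq_of_dcusp_liesOver S T h154 h14i hZ ha c _ hDa p hp,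
        N.bcPt_eq_of_dcusp_liesOver S T h154 h14i hZ hb c _ hDb p hp⟩
  obtain ⟨_, _, ea⟩ := N.nfPlace_eq_of_bcPt_eq S T ha a.2.1 a.2.2.1 a.2.2.2 p hpa
  obtain ⟨_, _, eb⟩ := N.nfPlace_eq_of_bcPt_eq S T hb b.2.1 b.2.2.1 b.2.2.2 p hpb
  rw [ea, eb]

/-! ### Level subgroups over a prescribed point of the compactification -/

/-- A point `w ∈ V_k` whose image in `Z_k` lies over `x ∈ V_i ⊆ Z_i` along `Z_k → Z_i` has its
decomposition group lying over `x`. [cite: MochizukiAbsTopIII2015, Thm 1.9 (a) p.37] -/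
theorem liesOver_decomp_of_bcPt_eq {i k : ι} (h : i ≤ k) (x : N.Point (S.V i)) (w : N.Point (S.V k))
    (hw : N.bcPt (T.hZZ h) (N.ptRes (S.isOpen k) w) = N.ptRes (S.isOpen i) x) :
    N.LiesOver S h (N.decomp (S.V k) w) x := by
  have himg : N.bcPt (T.hWV h) (N.ptRes (T.hVW h) w) = x :=
    (N.ptRes (S.isOpen i)).injective (by rw [N.ptRes_imgPt S T h w, hw])
  rw [← himg]
  exact N.liesOver_decomp_imgPt S T h w

/-- A cusp `c` of `V_k` filling a point of `Z_k` over `x ∈ V_i ⊆ Z_i` fills a point of `W_{ik}` over `x`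
(layer VI fibre law `exists_pt_bc_open`, layer IV `cuspPt_comp_some`/`cuspPt_comp_none`, layer I
`cuspPt_ne_ptRes`), hence its decomposition group lies over `x`.
[cite: MochizukiAbsTopIII2015, Thm 1.9 (a) p.37] -/
theorem liesOver_dcusp_of_bcPt_eq {i k : ι} (h : i ≤ k) (x : N.Point (S.V i))
    (c : (N.cusps (S.V k)).Cusp) (p : N.Point (S.Zb k)) (hc : N.cuspPt (S.isOpen k) c = some p)
    (hp : N.bcPt (T.hZZ h) p = N.ptRes (S.isOpen i) x) :
    N.LiesOver S h ((N.cusps (S.V k)).Dcusp c) x := by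
  obtain ⟨w₀, hw₀, hw₀x⟩ :=
    N.exists_pt_bc_open (T.hWV h) (T.hZZ h) (S.isOpen i) (T.hWZ h) x p hp
  have hcw : N.cuspPt (T.hVW h) c = some w₀ := by
    rcases hopt : N.cuspPt (T.hVW h) c with _ | w₁
    · exfalso
      have h1 := N.cuspPt_comp_none (T.hVW h) (T.hWZ h) (S.isOpen k) c hopt
      rw [hc, ← hw₀] at h1
      exact N.cuspPt_ne_ptRes (T.hWZ h) _ w₀ h1.symm
    · have h1 := N.cuspPt_comp_some (T.hVW h) (T.hWZ h) (S.isOpen k) c w₁ hopt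
      rw [hc, ← hw₀] at h1
      rw [(N.ptRes (T.hWZ h)).injective (Option.some_injective _ h1)]
  rw [← hw₀x]
  exact N.liesOver_dcusp_of_cuspPt S T h c w₀ hcw

/-! ### Equality of places implies `SamePoint` -/

/-- **`a` and `b` name the same place ⟹ `SamePoint a b`** (the (←) half of (e1)): equal names come from
a common point `x₃` of a common base change `Z₃` (layer III `exists_common_of_nfPlace_eq`); a level `k`
above `a`, `b` dominates `Z₃` (cofinality tag); the point of `Z_k` over `x₃` is a point or a cusp of `V_k`
(`exists_ptRes_or_cuspPt`), whose decomposition group lies over both.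
[cite: MochizukiAbsTopIII2015, Thm 1.9 (e) p.38] -/
theorem samePoint_of_nfPlace_eq [IsDirectedOrder ι] (a b : N.NFPointIndex S)
    (hab : N.nfPlace (T.hZb a.1) (N.ptRes (S.isOpen a.1) a.2.1)
        ((N.isNFPoint_ptRes (S.isOpen a.1) (S.isNFCurve a.1) a.2.1).2 a.2.2.1)
        ((N.isRationalPt_ptRes (S.isOpen a.1) a.2.1).2 a.2.2.2) =
      N.nfPlace (T.hZb b.1) (N.ptRes (S.isOpen b.1) b.2.1)
        ((N.isNFPoint_ptRes (S.isOpen b.1) (S.isNFCurve b.1) b.2.1).2 b.2.2.1)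
        ((N.isRationalPt_ptRes (S.isOpen b.1) b.2.1).2 b.2.2.2)) :
    N.SamePoint S a b := by
  obtain ⟨Z₃, g₁, g₂, x₃, hx₃a, hx₃b⟩ := N.exists_common_of_nfPlace_eq _ _ _ _ _ _ _ _ hab
  obtain ⟨k₀, hak₀, hk₀⟩ := T.cofinal a.1 Z₃ g₁
  obtain ⟨k, hk₀k, hbk⟩ := exists_ge_ge k₀ b.1
  have hak : a.1 ≤ k := hak₀.trans hk₀k
  have hk3 : N.IsBaseChangeOf (S.Zb k) Z₃ := N.isBaseChangeOf_trans (T.hZZ hk₀k) hk₀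
  obtain ⟨xk, hxk⟩ := N.bcPt_surjective hk3 x₃
  have hxa : N.bcPt (T.hZZ hak) xk = N.ptRes (S.isOpen a.1) a.2.1 := by
    rw [← N.bcPt_comp hk3 g₁ (T.hZZ hak) xk, hxk, hx₃a]
  have hxb : N.bcPt (T.hZZ hbk) xk = N.ptRes (S.isOpen b.1) b.2.1 := by
    rw [← N.bcPt_comp hk3 g₂ (T.hZZ hbk) xk, hxk, hx₃b]
  rcases N.exists_ptRes_or_cuspPt (S.isOpen k) xk with ⟨w, hw⟩ | ⟨c, hc⟩
  · have hwNF : N.IsNFPoint (S.V k) w := by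
      rw [← N.isNFPoint_ptRes (S.isOpen k) (S.isNFCurve k) w, hw,
        N.isNFPoint_bcPt (T.hZZ hak) (N.isNFCurve_of_isCofiniteOpen (S.isOpen a.1) (S.isNFCurve a.1)),
        hxa]
      exact (N.isNFPoint_ptRes (S.isOpen a.1) (S.isNFCurve a.1) a.2.1).2 a.2.2.1
    refine ⟨k, hak, hbk, N.decomp (S.V k) w, Or.inl ⟨w, hwNF, rfl⟩, ?_, ?_⟩
    · exact N.liesOver_decomp_of_bcPt_eq S T hak a.2.1 w (by rw [hw, hxa])
    · exact N.liesOver_decomp_of_bcPt_eq S T hbk b.2.1 w (by rw [hw, hxb])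
  · refine ⟨k, hak, hbk, (N.cusps (S.V k)).Dcusp c, Or.inr ⟨c, rfl⟩, ?_, ?_⟩
    · exact N.liesOver_dcusp_of_bcPt_eq S T hak a.2.1 c xk hc hxa
    · exact N.liesOver_dcusp_of_bcPt_eq S T hbk b.2.1 c xk hc hxb

/-! ### Saturation implies surjectivity onto the places -/

/-- **Every place of `K_{Z_NF}/k̄_NF` is named by a rational NF-point of some level of a SATURATED system**
(surjectivity in (e1)): a place is named by a rational NF-point `x′` of a finite base change (layer III
`nfPlace_surjective`); the geometric point under `x′` (the `Δ_Z`-class of the conjugate of `D_y` into which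
`D_{x′}` maps) is carried by a rational NF-point `x` of a level (`IsSaturated`); both name the same place
(layer VI `nfPlace_eq_of_decomp_le`). [cite: MochizukiAbsTopIII2015, Thm 1.9 (e) p.38] -/
theorem exists_index_nfPlace_eq (h154 : Rmk_1_5_4_i.{u}) (hZ : N.IsThm19dInput Z)
    (hS : N.IsSaturated S)
    (v : @PlaceOver ↥(N.kbarNF Z) (N.NFFunctionField Z) _ _ (N.nfAlgebra Z)) :
    ∃ a : N.NFPointIndex S,
      N.nfPlace (T.hZb a.1) (N.ptRes (S.isOpen a.1) a.2.1)
          ((N.isNFPoint_ptRes (S.isOpen a.1) (S.isNFCurve a.1) a.2.1).2 a.2.2.1)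
          ((N.isRationalPt_ptRes (S.isOpen a.1) a.2.1).2 a.2.2.2) = v := by
  obtain ⟨Z', h', x', hx', hr', hv⟩ := N.nfPlace_surjective Z hZ.isNFCurve hZ.isScheme hZ.isProper v
  have hy : N.IsNFPoint Z (N.bcPt h' x') := (N.isNFPoint_bcPt h' hZ.isNFCurve x').1 hx'
  obtain ⟨g, hg⟩ := N.decomp_bcPt h' x'
  obtain ⟨i, x, δ, hδ, hxnf, hxr, hle⟩ := hS (N.bcPt h' x') hy g
  refine ⟨⟨i, x, hxnf, hxr⟩, ?_⟩
  rw [← hv]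
  symm
  refine N.nfPlace_eq_of_decomp_le h' (S.isOpen i) (T.hZb i) hZ.isScheme hZ.two_le_genus
    (h154 _ hZ.isSubpadic) x' hx' hr' x _ _ (N.bcPt h' x') g 1 δ (N.ext Z).geom.one_mem hδ ?_ ?_
  · rwa [one_mul]
  · have h1 : S.toZ i = N.res (S.isOpen i) ≫ N.bc (T.hZb i) := by
      rw [CurveModel.NFComplementSystem.toZ, T.bc_eq i]
    rw [← h1]
    exact hle

/-- **The point dictionary (e1) of a saturated tagged system, derived from the laws**: the map "rational
NF-point of a level ↦ the place it names" identifies `SamePoint` with equality of places and is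
surjective. [cite: MochizukiAbsTopIII2015, Thm 1.9 (e) p.38] -/
theorem exists_pointDictionary [IsDirectedOrder ι] (h154 : Rmk_1_5_4_i.{u}) (h14i : N.Prop_1_4_i)
    (hZ : N.IsThm19dInput Z) (hS : N.IsSaturated S) :
    ∃ π : N.NFPointIndex S → @PlaceOver ↥(N.kbarNF Z) (N.NFFunctionField Z) _ _ (N.nfAlgebra Z),
      (∀ a b, N.SamePoint S a b ↔ π a = π b) ∧ Function.Surjective π ∧
        ∀ a, π a = N.nfPlace (T.hZb a.1) (N.ptRes (S.isOpen a.1) a.2.1)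
          ((N.isNFPoint_ptRes (S.isOpen a.1) (S.isNFCurve a.1) a.2.1).2 a.2.2.1)
          ((N.isRationalPt_ptRes (S.isOpen a.1) a.2.1).2 a.2.2.2) :=
  ⟨fun a => N.nfPlace (T.hZb a.1) (N.ptRes (S.isOpen a.1) a.2.1)
      ((N.isNFPoint_ptRes (S.isOpen a.1) (S.isNFCurve a.1) a.2.1).2 a.2.2.1)
      ((N.isRationalPt_ptRes (S.isOpen a.1) a.2.1).2 a.2.2.2),
    fun a b => ⟨N.nfPlace_eq_of_samePoint S T h154 h14i hZ a b, N.samePoint_of_nfPlace_eq S T a b⟩,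
    fun v => N.exists_index_nfPlace_eq S T h154 hZ hS v, fun _ => rfl⟩

end PlacedKummerModelV2

end Literature.AnabelianGeometry.AbsoluteAnabelian.AbsTopIII
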